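import Summits.BirchSwinnertonDyer.BirchSwinnertonDyer.Theorems.AdditiveBranchIMCGenusKolyvaginLabelsTraceCongruence
import Summits.BirchSwinnertonDyer.BirchSwinnertonDyer.Theorems.ErratumRoadFiveShimuraKolyvaginOrderBoundInertCarrierEuler
import Summits.BirchSwinnertonDyer.BirchSwinnertonDyer.Theorems.TwoAdicConverseGoodTwistsKolyvaginBigImage
import Summits.BirchSwinnertonDyer.BirchSwinnertonDyer.Theorems.AdditiveBranchIMCGenusGrossZagierHeegnerOne
import Summits.BirchSwinnertonDyer.BirchSwinnertonDyer.Theorems.SignedLowerHalvesKobayashiLowerHalfLargeImageBSTWTwistAuxWitness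
import Literature.NumberTheory.EllipticCurves.HeegnerPointsKolyvaginPrimaryEulerProofs
import Literature.NumberTheory.EllipticCurves.CaiShuTian2014.HeegnerConditionProofs
import Literature.NumberTheory.EllipticCurves.ExceptionalPrimesDensityModels
import Literature.NumberTheory.EllipticCurves.BSDSelmerSkinnerThmBProofs
import Literature.NumberTheory.EllipticCurves.PAdicHeights
import HarnessLib

/-!
# ER5 Euler half · genus line · the `E′`-side Kolyvagin data under the twist transport `Θ_θ`

Helpers for the genus line of `EulerHalfPOnlyMultPotMultTwinAtFive` (route ErratumRoadFive), (D″) currency: the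
ring-class-rational genus Kolyvagin system of `W ≅ C₂ • (D • E′)^{(d₁)}` over `K[m]` is the `Θ_ϑ`-transport of the
`χ`-twisted system of the fourth curve `E′` (`genusKolyvaginPointsR_of_facts`, §4).  A consumer delivering the
point-divisibility clause (D″) for `W` from McCallum's (5)–(6) run on `E′` needs, in the skeleton spelling of
`AdditiveBranchIMCGenusKolyvaginTransportAdapters` (arbitrary `DecidableEq L`): §A `Θ ∘ D_ℓ = D_ℓ ∘ Θ`,
`Θ ∘ D_n = D_n ∘ Θ` (`σ_ℓ θ = θ`), `Θ(Σ_τ χ(τ) τ D_n y) = P(n)(Θ y)` and the divisibility transport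
`n • Q = P^χ_{E′}(n) ⇒ n • Θ Q = P_W(n)` (operator currency `KolyvaginOperator`); §A′ the same in the engine's
group-ring currency `KolyvaginEuler.grAct/derivProd/kolyvaginPoint`; §B a Gross Kolyvagin prime of level `M` for
`(W, K, p)` is a Zhang Kolyvagin prime for `(E′, K, p)` with `M ≤ M(ℓ)` (`a_ℓ(E′) = (d₁/ℓ) a_ℓ(W)`); §C the fourth
curve's frame at `p` (`E′` multiplicative, `ρ̄_{E′,p}` onto, `v_p Δ_min(E′) = v_p Δ_min(W)`, `p ∥ N_{E′}`).
presearch: "twist Heegner Kolyvagin derivative commutes isomorphism K(√d)" → [corpus:GrossLMS1991 §3–§4] only (the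
operators are `ℤ[G_n]`-elements, `Θ` is `G_n`-equivariant over `K[1] ∋ θ`); galaxy "twisted Heegner|genus character
Heegner" → context only; nothing typed.  No summit statement is proved here.
[cite: GrossLMS1991, §3 (3.5), §4 (4.1)] [cite: McCallumLMS1991, §4 (5)–(6)] [cite: WZhang2014, Notations (xii), §3.7]
[cite: SilvermanAEC2009, X.2 Prop. 2.4, X.5 Cor. 5.4, VII.5 Prop. 5.1]
-/

noncomputable section

set_option linter.dupNamespace false
set_option autoImplicit false

namespace Summit.BirchSwinnertonDyer.BirchSwinnertonDyer.Theorems.GenusKolyvagin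

open scoped NumberTheorySymbols
open WeierstrassCurve Literature.NumberTheory.EllipticCurves Finset
  Literature.NumberTheory.EllipticCurves.ModularForms
  Literature.NumberTheory.EllipticCurves.BurungaleSkinnerTianWan2024
open Summit.BirchSwinnertonDyer.BirchSwinnertonDyer.Theorems

universe v

/-! ## §A Operator currency: `Θ` commutes with `D_ℓ`, `D_n` and carries `P^χ(n)` to `P(n)` -/

section Operator

variable (E' : WeierstrassCurve ℚ) (D C₂ : VariableChange ℚ) [(D • E').IsCharNeTwoNF] (d : ℚ)
  {L : Type v} [Field L] [Algebra ℚ L] [instL : DecidableEq L] {θ : L}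

omit instL in
/-- Powers of an automorphism fixing `θ` fix `θ`. [folklore] -/
theorem algEquiv_pow_apply_of_apply_eq {σ : L ≃ₐ[ℚ] L} (hσ : σ θ = θ) (i : ℕ) : (σ ^ i) θ = θ := by
  induction i with
  | zero => rw [pow_zero]; rfl
  | succ i ih => rw [pow_succ, AlgEquiv.mul_apply, hσ, ih]

/-- **`σ(Θ P) = Θ(σ P)` for `σ θ = θ`** (skeleton spelling; `pointGalHom_twist'` at `u = 1`).
[cite: SilvermanAEC2009, X.5 Cor. 5.4] -/
theorem pointGalHom_twist_of_apply_eq' (hθ2 : θ ^ 2 = algebraMap ℚ L d) (hθ : θ ≠ 0) (σ : L ≃ₐ[ℚ] L)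
    (hσ : σ θ = θ) (P : (E'.baseChange L).toAffine.Point) :
    pointGalHom (C₂ • (D • E').quadraticTwist d) L σ (VariableChange.pointEquivBaseChange ((D • E').quadraticTwist d) C₂ L
          ((VariableChange.pointEquiv (((D • E').quadraticTwist d).baseChange L) (untwistAt hθ)).symm
            ((Affine.Point.congrEquiv (untwistAt_smul_eq (D • E') hθ2 hθ)).symm
              (VariableChange.pointEquivBaseChange E' D L (P))))) = (VariableChange.pointEquivBaseChange ((D • E').quadraticTwist d) C₂ L
          ((VariableChange.pointEquiv (((D • E').quadraticTwist d).baseChange L) (untwistAt hθ)).symm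
            ((Affine.Point.congrEquiv (untwistAt_smul_eq (D • E') hθ2 hθ)).symm
              (VariableChange.pointEquivBaseChange E' D L (pointGalHom E' L σ P))))) := by
  have h := pointGalHom_twist' E' D C₂ d hθ2 hθ σ (u := 1) (Or.inl rfl) (by rw [Int.cast_one, one_mul]; exact hσ) P
  rwa [one_zsmul] at h

/-- **`Θ(D_ℓ P) = D_ℓ(Θ P)`** for Kolyvagin's `D_ℓ = Σ i σ^i` with `σ θ = θ`. [cite: GrossLMS1991, §3 (3.5)] -/
theorem twist_derivOp' (hθ2 : θ ^ 2 = algebraMap ℚ L d) (hθ : θ ≠ 0) {σ : L ≃ₐ[ℚ] L} (hσ : σ θ = θ)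
    (ℓ : ℕ) (P : (E'.baseChange L).toAffine.Point) :
    (VariableChange.pointEquivBaseChange ((D • E').quadraticTwist d) C₂ L
          ((VariableChange.pointEquiv (((D • E').quadraticTwist d).baseChange L) (untwistAt hθ)).symm
            ((Affine.Point.congrEquiv (untwistAt_smul_eq (D • E') hθ2 hθ)).symm
              (VariableChange.pointEquivBaseChange E' D L (KolyvaginOperator.derivOp (pointGalHom E' L) σ ℓ P))))) =
      KolyvaginOperator.derivOp (pointGalHom (C₂ • (D • E').quadraticTwist d) L) σ ℓ (VariableChange.pointEquivBaseChange ((D • E').quadraticTwist d) C₂ L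
          ((VariableChange.pointEquiv (((D • E').quadraticTwist d).baseChange L) (untwistAt hθ)).symm
            ((Affine.Point.congrEquiv (untwistAt_smul_eq (D • E') hθ2 hθ)).symm
              (VariableChange.pointEquivBaseChange E' D L (P))))) := by
  unfold KolyvaginOperator.derivOp
  simp only [map_sum, map_nsmul]
  refine Finset.sum_congr rfl fun i _ ↦ ?_
  rw [pointGalHom_twist_of_apply_eq' E' D C₂ d hθ2 hθ (σ ^ i) (algEquiv_pow_apply_of_apply_eq hσ i) P]

/-- **`Θ(D_n P) = D_n(Θ P)`** along a list of primes whose `σ_ℓ` fix `θ`. [cite: GrossLMS1991, §3 (D_n)] -/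
theorem twist_derivOpProd' (hθ2 : θ ^ 2 = algebraMap ℚ L d) (hθ : θ ≠ 0) (σ : ℕ → (L ≃ₐ[ℚ] L))
    (l : List ℕ) (hσ : ∀ ℓ ∈ l, σ ℓ θ = θ) (P : (E'.baseChange L).toAffine.Point) :
    (VariableChange.pointEquivBaseChange ((D • E').quadraticTwist d) C₂ L
          ((VariableChange.pointEquiv (((D • E').quadraticTwist d).baseChange L) (untwistAt hθ)).symm
            ((Affine.Point.congrEquiv (untwistAt_smul_eq (D • E') hθ2 hθ)).symm
              (VariableChange.pointEquivBaseChange E' D L (KolyvaginOperator.derivOpProd (pointGalHom E' L) σ l P))))) =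
      KolyvaginOperator.derivOpProd (pointGalHom (C₂ • (D • E').quadraticTwist d) L) σ l (VariableChange.pointEquivBaseChange ((D • E').quadraticTwist d) C₂ L
          ((VariableChange.pointEquiv (((D • E').quadraticTwist d).baseChange L) (untwistAt hθ)).symm
            ((Affine.Point.congrEquiv (untwistAt_smul_eq (D • E') hθ2 hθ)).symm
              (VariableChange.pointEquivBaseChange E' D L (P))))) := by
  induction l with
  | nil => rfl
  | cons ℓ l ih =>
    rw [KolyvaginOperator.derivOpProd_cons, KolyvaginOperator.derivOpProd_cons,
      twist_derivOp' E' D C₂ d hθ2 hθ (hσ ℓ (by simp)) ℓ,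
      ih (fun ℓ' h ↦ hσ ℓ' (List.mem_cons_of_mem ℓ h))]

/-- **The `χ`-twisted derived point of `E′` transports to Kolyvagin's derived point of `W`**:
`Θ(Σ_{τ ∈ S} s(τ) • τ D_n y) = P(n)(Θ y) = Σ_{τ ∈ S} τ D_n (Θ y)` when `τ θ = s(τ) θ` (`s = ±1` on `S`) and the
`σ_ℓ` fix `θ`. [cite: GrossLMS1991, §4 (4.1)] [cite: SilvermanAEC2009, X.2 Prop. 2.4] -/
theorem twist_signedSum_eq_derivedPoint' (hθ2 : θ ^ 2 = algebraMap ℚ L d) (hθ : θ ≠ 0)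
    (S : Finset (L ≃ₐ[ℚ] L)) (s : (L ≃ₐ[ℚ] L) → ℤ) (hs : ∀ τ ∈ S, s τ = 1 ∨ s τ = -1)
    (hS : ∀ τ ∈ S, τ θ = (s τ : L) * θ) (σ : ℕ → (L ≃ₐ[ℚ] L)) (m : ℕ)
    (hσ : ∀ ℓ ∈ m.primeFactorsList, σ ℓ θ = θ) (y : (E'.baseChange L).toAffine.Point) :
    (VariableChange.pointEquivBaseChange ((D • E').quadraticTwist d) C₂ L
          ((VariableChange.pointEquiv (((D • E').quadraticTwist d).baseChange L) (untwistAt hθ)).symm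
            ((Affine.Point.congrEquiv (untwistAt_smul_eq (D • E') hθ2 hθ)).symm
              (VariableChange.pointEquivBaseChange E' D L (∑ τ ∈ S, s τ • pointGalHom E' L τ (KolyvaginOperator.derivOpProd (pointGalHom E' L) σ m.primeFactorsList y)))))) =
      KolyvaginOperator.derivedPoint (pointGalHom (C₂ • (D • E').quadraticTwist d) L) σ m S (VariableChange.pointEquivBaseChange ((D • E').quadraticTwist d) C₂ L
          ((VariableChange.pointEquiv (((D • E').quadraticTwist d).baseChange L) (untwistAt hθ)).symm
            ((Affine.Point.congrEquiv (untwistAt_smul_eq (D • E') hθ2 hθ)).symm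
              (VariableChange.pointEquivBaseChange E' D L (y))))) := by
  refine (twist_sum_smul_pointGalHom' E' D C₂ d hθ2 hθ S (fun τ ↦ τ) s hs hS _).trans ?_
  unfold KolyvaginOperator.derivedPoint
  refine Finset.sum_congr rfl fun τ _ ↦ ?_
  rw [twist_derivOpProd' E' D C₂ d hθ2 hθ σ _ hσ y]

/-- **Divisibility transports**: `n • Q = P^χ_{E′}(n)` in `E′(L)` gives `n • Θ Q = P_W(n)(Θ y)` in `W(L)`.
[cite: McCallumLMS1991, §4 (5)–(6)] [cite: SilvermanAEC2009, X.5 Cor. 5.4] -/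
theorem zsmul_twist_eq_derivedPoint_of_zsmul_eq' (hθ2 : θ ^ 2 = algebraMap ℚ L d) (hθ : θ ≠ 0)
    (S : Finset (L ≃ₐ[ℚ] L)) (s : (L ≃ₐ[ℚ] L) → ℤ) (hs : ∀ τ ∈ S, s τ = 1 ∨ s τ = -1)
    (hS : ∀ τ ∈ S, τ θ = (s τ : L) * θ) (σ : ℕ → (L ≃ₐ[ℚ] L)) (m : ℕ)
    (hσ : ∀ ℓ ∈ m.primeFactorsList, σ ℓ θ = θ) (y : (E'.baseChange L).toAffine.Point)
    {n : ℤ} {Q : (E'.baseChange L).toAffine.Point}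
    (hQ : n • Q = ∑ τ ∈ S, s τ • pointGalHom E' L τ
      (KolyvaginOperator.derivOpProd (pointGalHom E' L) σ m.primeFactorsList y)) :
    n • (VariableChange.pointEquivBaseChange ((D • E').quadraticTwist d) C₂ L
          ((VariableChange.pointEquiv (((D • E').quadraticTwist d).baseChange L) (untwistAt hθ)).symm
            ((Affine.Point.congrEquiv (untwistAt_smul_eq (D • E') hθ2 hθ)).symm
              (VariableChange.pointEquivBaseChange E' D L (Q))))) =
      KolyvaginOperator.derivedPoint (pointGalHom (C₂ • (D • E').quadraticTwist d) L) σ m S (VariableChange.pointEquivBaseChange ((D • E').quadraticTwist d) C₂ L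
          ((VariableChange.pointEquiv (((D • E').quadraticTwist d).baseChange L) (untwistAt hθ)).symm
            ((Affine.Point.congrEquiv (untwistAt_smul_eq (D • E') hθ2 hθ)).symm
              (VariableChange.pointEquivBaseChange E' D L (y))))) := by
  rw [← twist_signedSum_eq_derivedPoint' E' D C₂ d hθ2 hθ S s hs hS σ m hσ y, ← hQ]
  simp only [map_zsmul]

end Operator

/-! ## §A′ Group-ring currency (`KolyvaginEuler`): the engine's `grAct (derivProd σ L)` and `kolyvaginPoint` -/

section Engine

variable (E' : WeierstrassCurve ℚ) (D C₂ : VariableChange ℚ) [(D • E').IsCharNeTwoNF] (d : ℚ)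
  {L : Type v} [Field L] [Algebra ℚ L] [instL : DecidableEq L] {θ : L}
  {𝒢 : Type*} [CommGroup 𝒢] (ρ : 𝒢 →* (L ≃ₐ[ℚ] L))
  [DistribMulAction 𝒢 (E'.baseChange L).toAffine.Point]
  [DistribMulAction 𝒢 ((C₂ • (D • E').quadraticTwist d).baseChange L).toAffine.Point]

/-- **`Θ(g • P) = g • Θ P`** for a group `𝒢` acting on both point groups through `ρ : 𝒢 → Aut_ℚ(L)` with
`ρ(g) θ = θ`. [cite: SilvermanAEC2009, X.5 Cor. 5.4] -/
theorem twist_smul_of_apply_eq' (hθ2 : θ ^ 2 = algebraMap ℚ L d) (hθ : θ ≠ 0)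
    (hsmulE : ∀ (g : 𝒢) (P : (E'.baseChange L).toAffine.Point), g • P = pointGalHom E' L (ρ g) P)
    (hsmulW : ∀ (g : 𝒢) (P : ((C₂ • (D • E').quadraticTwist d).baseChange L).toAffine.Point),
      g • P = pointGalHom (C₂ • (D • E').quadraticTwist d) L (ρ g) P)
    {g : 𝒢} (hg : ρ g θ = θ) (P : (E'.baseChange L).toAffine.Point) :
    (VariableChange.pointEquivBaseChange ((D • E').quadraticTwist d) C₂ L
          ((VariableChange.pointEquiv (((D • E').quadraticTwist d).baseChange L) (untwistAt hθ)).symm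
            ((Affine.Point.congrEquiv (untwistAt_smul_eq (D • E') hθ2 hθ)).symm
              (VariableChange.pointEquivBaseChange E' D L (g • P))))) = g • (VariableChange.pointEquivBaseChange ((D • E').quadraticTwist d) C₂ L
          ((VariableChange.pointEquiv (((D • E').quadraticTwist d).baseChange L) (untwistAt hθ)).symm
            ((Affine.Point.congrEquiv (untwistAt_smul_eq (D • E') hθ2 hθ)).symm
              (VariableChange.pointEquivBaseChange E' D L (P))))) := by
  rw [hsmulE, hsmulW, pointGalHom_twist_of_apply_eq' E' D C₂ d hθ2 hθ (ρ g) hg P]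

/-- **`Θ(D_ℓ P) = D_ℓ(Θ P)`** in group-ring currency (`grAct (derivElt g ℓ)`), `ρ(g) θ = θ`.
[cite: GrossLMS1991, §3 (3.5)] -/
theorem twist_grAct_derivElt' (hθ2 : θ ^ 2 = algebraMap ℚ L d) (hθ : θ ≠ 0)
    (hsmulE : ∀ (g : 𝒢) (P : (E'.baseChange L).toAffine.Point), g • P = pointGalHom E' L (ρ g) P)
    (hsmulW : ∀ (g : 𝒢) (P : ((C₂ • (D • E').quadraticTwist d).baseChange L).toAffine.Point),
      g • P = pointGalHom (C₂ • (D • E').quadraticTwist d) L (ρ g) P)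
    {g : 𝒢} (hg : ρ g θ = θ) (ℓ : ℕ) (P : (E'.baseChange L).toAffine.Point) :
    (VariableChange.pointEquivBaseChange ((D • E').quadraticTwist d) C₂ L
          ((VariableChange.pointEquiv (((D • E').quadraticTwist d).baseChange L) (untwistAt hθ)).symm
            ((Affine.Point.congrEquiv (untwistAt_smul_eq (D • E') hθ2 hθ)).symm
              (VariableChange.pointEquivBaseChange E' D L (KolyvaginEuler.grAct _ (KolyvaginEuler.derivElt g ℓ) P))))) =
      KolyvaginEuler.grAct _ (KolyvaginEuler.derivElt g ℓ) (VariableChange.pointEquivBaseChange ((D • E').quadraticTwist d) C₂ L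
          ((VariableChange.pointEquiv (((D • E').quadraticTwist d).baseChange L) (untwistAt hθ)).symm
            ((Affine.Point.congrEquiv (untwistAt_smul_eq (D • E') hθ2 hθ)).symm
              (VariableChange.pointEquivBaseChange E' D L (P))))) := by
  rw [KolyvaginEuler.grAct_derivElt, KolyvaginEuler.grAct_derivElt]
  simp only [map_sum, map_nsmul]
  refine Finset.sum_congr rfl fun i _ ↦ ?_
  rw [twist_smul_of_apply_eq' E' D C₂ d ρ hθ2 hθ hsmulE hsmulW
    (by rw [map_pow]; exact algEquiv_pow_apply_of_apply_eq hg i) P]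

/-- **`Θ(D_n P) = D_n(Θ P)`** in group-ring currency (`grAct (derivProd σ T)`), the `ρ(σ_ℓ)` fixing `θ`.
[cite: GrossLMS1991, §3 (D_n)] -/
theorem twist_grAct_derivProd' (hθ2 : θ ^ 2 = algebraMap ℚ L d) (hθ : θ ≠ 0)
    (hsmulE : ∀ (g : 𝒢) (P : (E'.baseChange L).toAffine.Point), g • P = pointGalHom E' L (ρ g) P)
    (hsmulW : ∀ (g : 𝒢) (P : ((C₂ • (D • E').quadraticTwist d).baseChange L).toAffine.Point),
      g • P = pointGalHom (C₂ • (D • E').quadraticTwist d) L (ρ g) P)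
    (σ : ℕ → 𝒢) (T : Finset ℕ) (hσ : ∀ ℓ ∈ T, ρ (σ ℓ) θ = θ) (P : (E'.baseChange L).toAffine.Point) :
    (VariableChange.pointEquivBaseChange ((D • E').quadraticTwist d) C₂ L
          ((VariableChange.pointEquiv (((D • E').quadraticTwist d).baseChange L) (untwistAt hθ)).symm
            ((Affine.Point.congrEquiv (untwistAt_smul_eq (D • E') hθ2 hθ)).symm
              (VariableChange.pointEquivBaseChange E' D L (KolyvaginEuler.grAct _ (KolyvaginEuler.derivProd σ T) P))))) =
      KolyvaginEuler.grAct _ (KolyvaginEuler.derivProd σ T) (VariableChange.pointEquivBaseChange ((D • E').quadraticTwist d) C₂ L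
          ((VariableChange.pointEquiv (((D • E').quadraticTwist d).baseChange L) (untwistAt hθ)).symm
            ((Affine.Point.congrEquiv (untwistAt_smul_eq (D • E') hθ2 hθ)).symm
              (VariableChange.pointEquivBaseChange E' D L (P))))) := by
  induction T using Finset.induction_on with
  | empty => simp only [KolyvaginEuler.derivProd_empty, KolyvaginEuler.grAct_one]
  | @insert a T ha ih =>
    have hT : ∀ ℓ ∈ T, ρ (σ ℓ) θ = θ := fun ℓ h ↦ hσ ℓ (Finset.mem_insert_of_mem h)
    have hprod : KolyvaginEuler.derivProd σ (insert a T) =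
        KolyvaginEuler.derivElt (σ a) a * KolyvaginEuler.derivProd σ T := Finset.prod_insert ha
    rw [hprod, KolyvaginEuler.grAct_mul, KolyvaginEuler.grAct_mul,
      twist_grAct_derivElt' E' D C₂ d ρ hθ2 hθ hsmulE hsmulW (hσ a (Finset.mem_insert_self a T)) a, ih hT]

/-- **The signed genus sum of `E′` transports to Kolyvagin's point of `W`** (engine currency):
`Θ(Σ_q sg(f q) • f q • D_T y) = kolyvaginPoint σ T f (Θ y)` when `ρ(f q) θ = sg(f q) θ` (`sg = ±1`) and the
`ρ(σ_ℓ)`, `ℓ ∈ T`, fix `θ`. [cite: GrossLMS1991, §4 (4.1)] [cite: SilvermanAEC2009, X.2 Prop. 2.4] -/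
theorem twist_signedSum_eq_kolyvaginPoint' (hθ2 : θ ^ 2 = algebraMap ℚ L d) (hθ : θ ≠ 0)
    (hsmulE : ∀ (g : 𝒢) (P : (E'.baseChange L).toAffine.Point), g • P = pointGalHom E' L (ρ g) P)
    (hsmulW : ∀ (g : 𝒢) (P : ((C₂ • (D • E').quadraticTwist d).baseChange L).toAffine.Point),
      g • P = pointGalHom (C₂ • (D • E').quadraticTwist d) L (ρ g) P)
    {H : Subgroup 𝒢} [Fintype (𝒢 ⧸ H)] (f : 𝒢 ⧸ H → 𝒢) (sg : 𝒢 → ℤ)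
    (hsg : ∀ q, sg (f q) = 1 ∨ sg (f q) = -1) (hf : ∀ q, ρ (f q) θ = (sg (f q) : L) * θ)
    (σ : ℕ → 𝒢) (T : Finset ℕ) (hσ : ∀ ℓ ∈ T, ρ (σ ℓ) θ = θ) (y : (E'.baseChange L).toAffine.Point) :
    (VariableChange.pointEquivBaseChange ((D • E').quadraticTwist d) C₂ L
          ((VariableChange.pointEquiv (((D • E').quadraticTwist d).baseChange L) (untwistAt hθ)).symm
            ((Affine.Point.congrEquiv (untwistAt_smul_eq (D • E') hθ2 hθ)).symm
              (VariableChange.pointEquivBaseChange E' D L (∑ q, sg (f q) • f q • KolyvaginEuler.grAct _ (KolyvaginEuler.derivProd σ T) y))))) =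
      KolyvaginEuler.kolyvaginPoint σ T f (VariableChange.pointEquivBaseChange ((D • E').quadraticTwist d) C₂ L
          ((VariableChange.pointEquiv (((D • E').quadraticTwist d).baseChange L) (untwistAt hθ)).symm
            ((Affine.Point.congrEquiv (untwistAt_smul_eq (D • E') hθ2 hθ)).symm
              (VariableChange.pointEquivBaseChange E' D L (y))))) := by
  unfold KolyvaginEuler.kolyvaginPoint
  simp only [map_sum, map_zsmul]
  refine Finset.sum_congr rfl fun q _ ↦ ?_
  rw [← twist_grAct_derivProd' E' D C₂ d ρ hθ2 hθ hsmulE hsmulW σ T hσ y, hsmulW, hsmulE,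
    pointGalHom_twist' E' D C₂ d hθ2 hθ (ρ (f q)) (hsg q) (hf q)]

/-- **Divisibility transports** (engine currency): `n • Q = Σ_q sg(f q) • f q • D_T y` in `E′(L)` gives
`n • Θ Q = kolyvaginPoint σ T f (Θ y)` in `W(L)`. [cite: McCallumLMS1991, §4 (5)–(6)] -/
theorem zsmul_twist_eq_kolyvaginPoint_of_zsmul_eq' (hθ2 : θ ^ 2 = algebraMap ℚ L d) (hθ : θ ≠ 0)
    (hsmulE : ∀ (g : 𝒢) (P : (E'.baseChange L).toAffine.Point), g • P = pointGalHom E' L (ρ g) P)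
    (hsmulW : ∀ (g : 𝒢) (P : ((C₂ • (D • E').quadraticTwist d).baseChange L).toAffine.Point),
      g • P = pointGalHom (C₂ • (D • E').quadraticTwist d) L (ρ g) P)
    {H : Subgroup 𝒢} [Fintype (𝒢 ⧸ H)] (f : 𝒢 ⧸ H → 𝒢) (sg : 𝒢 → ℤ)
    (hsg : ∀ q, sg (f q) = 1 ∨ sg (f q) = -1) (hf : ∀ q, ρ (f q) θ = (sg (f q) : L) * θ)
    (σ : ℕ → 𝒢) (T : Finset ℕ) (hσ : ∀ ℓ ∈ T, ρ (σ ℓ) θ = θ) (y : (E'.baseChange L).toAffine.Point)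
    {n : ℤ} {Q : (E'.baseChange L).toAffine.Point}
    (hQ : n • Q = ∑ q, sg (f q) • f q • KolyvaginEuler.grAct _ (KolyvaginEuler.derivProd σ T) y) :
    n • (VariableChange.pointEquivBaseChange ((D • E').quadraticTwist d) C₂ L
          ((VariableChange.pointEquiv (((D • E').quadraticTwist d).baseChange L) (untwistAt hθ)).symm
            ((Affine.Point.congrEquiv (untwistAt_smul_eq (D • E') hθ2 hθ)).symm
              (VariableChange.pointEquivBaseChange E' D L (Q))))) = KolyvaginEuler.kolyvaginPoint σ T f (VariableChange.pointEquivBaseChange ((D • E').quadraticTwist d) C₂ L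
          ((VariableChange.pointEquiv (((D • E').quadraticTwist d).baseChange L) (untwistAt hθ)).symm
            ((Affine.Point.congrEquiv (untwistAt_smul_eq (D • E') hθ2 hθ)).symm
              (VariableChange.pointEquivBaseChange E' D L (y))))) := by
  rw [← twist_signedSum_eq_kolyvaginPoint' E' D C₂ d ρ hθ2 hθ hsmulE hsmulW f sg hsg hf σ T hσ y, ← hQ]
  simp only [map_zsmul]

end Engine

/-! ## §B Kolyvagin primes of `W` are Zhang–Kolyvagin primes of `E′` of index `≥ M` -/

section KolyvaginPrimes

open IsDedekindDomain NumberField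

/-- **A Gross Kolyvagin prime `ℓ` of level `M` for `(W, K, p)` is a Zhang Kolyvagin prime of `E′ ≅ W^{(d₁)}`
with `M ≤ M(ℓ)`** (`d₁ ∣ d_K`, `p ≥ 5`): `ℓ ∤ N_W d_K p` inert, `ℓ` odd (`p ∣ ℓ + 1`), so `ℓ ∤ d₁`, `E′` is good
at `ℓ` (`N_{E′}` prime to `ℓ`), and `a_ℓ(E′) = (d₁/ℓ)·a_ℓ(W)` with `p^M ∣ a_ℓ(W)`, `p^M ∣ ℓ + 1` (Gross (3.3)).
[cite: GrossLMS1991, §3 (3.1)–(3.3)] [cite: WZhang2014, Notations (xii)] [cite: SilvermanAEC2009, X.2 Prop. 2.4] -/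
theorem zhang_isKolyvaginPrime_of_twist_presentation (W E' : WeierstrassCurve ℚ) [W.IsElliptic]
    [W.IsGloballyMinimal] [E'.IsElliptic] [E'.IsGloballyMinimal] {d₁ : ℤ}
    (hE' : ∃ C : VariableChange ℚ, C • W.quadraticTwist (d₁ : ℚ) = E')
    {K : Type} [Field K] [NumberField K] (hd₁ : d₁ ∣ NumberField.discr K)
    {N : ℕ} [NeZero N] (hN : W.conductorNorm ℤ = N) (DtW : ModularParametrizationData W N)
    {p : ℕ} [Fact p.Prime] (hp5 : 5 ≤ p) {ℓ : ℕ} (hℓ : IsKolyvaginPrime N W K p ℓ)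
    {M : ℕ} (hM : 1 ≤ M) (hℓM : FrobEqFrobInfty W K (p ^ M) ℓ) :
    Zhang2014.IsKolyvaginPrime (E'.conductorNorm ℤ) E' K p ℓ ∧ M ≤ Zhang2014.kolyvaginIndex E' p ℓ := by
  have hp : p.Prime := Fact.out
  haveI : Fact ℓ.Prime := ⟨hℓ.1⟩
  have hℓ2 : ℓ ≠ 2 := kolyvaginPrime_ne_two W hp5 hp hℓ
  have hℓd : ¬ (ℓ : ℤ) ∣ d₁ := fun h ↦ hℓ.2.2.1 (h.trans hd₁)
  have hgoodW : W.HasGoodReductionAtPrime ℓ := by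
    have h : ¬ ℓ ∣ W.conductorNorm ℤ := by rw [hN]; exact hℓ.2.1
    exact not_not.mp (mt (W.dvd_conductorNorm_iff_not_hasGoodReductionAtPrime ℓ).mpr h)
  have hgoodE : E'.HasGoodReductionAtPrime ℓ :=
    hasGoodReductionAtPrime_of_twist_presentation W E' hE' hℓ2 hℓd hgoodW
  have hℓNE : ¬ ℓ ∣ E'.conductorNorm ℤ := fun h ↦
    (E'.dvd_conductorNorm_iff_not_hasGoodReductionAtPrime ℓ).mp h hgoodE
  have haW : ((p ^ M : ℕ) : ℤ) ∣ W.frobeniusTrace ℓ := pow_dvd_frobeniusTrace_of_kolyvaginPrime DtW hp hM hℓ hℓM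
  have hrel : E'.frobeniusTrace ℓ = J(d₁ | ℓ) * W.frobeniusTrace ℓ := by
    obtain ⟨C, hC⟩ := hE'
    subst hC
    have hd0 : (d₁ : ℚ) ≠ 0 := by exact_mod_cast (show d₁ ≠ 0 by rintro rfl; exact hℓd (dvd_zero _))
    haveI := W.isElliptic_quadraticTwist hd0
    obtain ⟨v, hv⟩ : ∃ v : HeightOneSpectrum (𝓞 ℚ), (Rat.HeightOneSpectrum.primesEquiv v : ℕ) = ℓ :=
      ⟨Rat.HeightOneSpectrum.primesEquiv.symm ⟨ℓ, hℓ.1⟩, by rw [Equiv.apply_symm_apply]⟩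
    rw [← LFunction_apply_prime_eq_frobeniusTrace _ ℓ hgoodE, ← LFunction_apply_prime_eq_frobeniusTrace W ℓ hgoodW,
      LFunction_smul]
    have key := W.LFunction_quadraticTwist_intCast_apply_prime_of_not_dvd d₁ v (by rw [hv]; exact hℓ2)
      (by rw [hv]; exact hℓd)
    rw [hv] at key
    exact key
  have hidx : M ≤ Zhang2014.kolyvaginIndex E' p ℓ := by
    rw [Zhang2014.le_kolyvaginIndex_iff]
    refine ⟨pow_dvd_add_one_of_frobEqFrobInfty W (K := K) hp hM hℓ.1 hℓ.2.2.2.1 hℓM, ?_⟩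
    rw [hrel]
    have h' : ((p : ℤ) ^ M) ∣ W.frobeniusTrace ℓ := by exact_mod_cast haW
    exact h'.mul_left _
  exact ⟨⟨hℓ.1, hℓNE, hℓ.2.2.1, hℓ.2.2.2.1, hℓ.2.2.2.2.1, lt_of_lt_of_le hM hidx⟩, hidx⟩

end KolyvaginPrimes

/-! ## §C The fourth curve's frame at `p` -/

section Frame

open Summit.BirchSwinnertonDyer.BirchSwinnertonDyer.Theorems.GenusGrossZagier
open Summit.BirchSwinnertonDyer.BirchSwinnertonDyer.Theorems.TwoAdicKolyvaginGoodTwists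
open Summit.BirchSwinnertonDyer.BirchSwinnertonDyer.Theorems.X7Twist

/-- **`E′ ≅ W^{(d₁)}` is multiplicative at an odd `p ∤ d₁` where `W` is** (twist by a `p`-unit; model
independence). [cite: SilvermanAEC2009, VII.5 Prop. 5.1, VII.1 Prop. 1.3] -/
theorem hasMultiplicativeReductionAtPrime_of_twist_presentation (W E' : WeierstrassCurve ℚ) [W.IsElliptic]
    [E'.IsElliptic] {d₁ : ℤ} (hE' : ∃ C : VariableChange ℚ, C • W.quadraticTwist (d₁ : ℚ) = E')
    {p : ℕ} [Fact p.Prime] (hp2 : p ≠ 2) (hd0 : d₁ ≠ 0) (hpd : ¬ (p : ℤ) ∣ d₁)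
    (hmult : W.HasMultiplicativeReductionAtPrime p) : E'.HasMultiplicativeReductionAtPrime p := by
  obtain ⟨C, hC⟩ := hE'
  haveI := W.isElliptic_quadraticTwist (show (d₁ : ℚ) ≠ 0 by exact_mod_cast hd0)
  have h := (hasMultiplicativeReductionAtPrime_smul_iff (W.quadraticTwist (d₁ : ℚ)) C p).mpr
    ((hasMultiplicativeReductionAtPrime_quadraticTwist_iff_of_odd W hp2 hd0 hpd).mpr hmult)
  rw [hC] at h
  exact h

/-- **`p ∥ N_{E′}`** for `E′ ≅ W^{(d₁)}` with `W` multiplicative at the odd prime `p ∤ d₁` (`f_p = 1`).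
[cite: SilvermanATAEC1994, IV.10.2 (b)] -/
theorem factorization_conductorNorm_eq_one_of_twist_presentation (W E' : WeierstrassCurve ℚ) [W.IsElliptic]
    [E'.IsElliptic] {d₁ : ℤ} (hE' : ∃ C : VariableChange ℚ, C • W.quadraticTwist (d₁ : ℚ) = E')
    {p : ℕ} [Fact p.Prime] (hp2 : p ≠ 2) (hd0 : d₁ ≠ 0) (hpd : ¬ (p : ℤ) ∣ d₁)
    (hmult : W.HasMultiplicativeReductionAtPrime p) :
    (E'.conductorNorm ℤ).factorization p = 1 ∧
      ∃ N₀ : ℕ, E'.conductorNorm ℤ = N₀ * p ∧ ¬ p ∣ N₀ ∧ N₀ ≠ 0 := by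
  have hp : p.Prime := Fact.out
  have hmE := hasMultiplicativeReductionAtPrime_of_twist_presentation W E' hE' hp2 hd0 hpd hmult
  have hfac : (E'.conductorNorm ℤ).factorization p = 1 :=
    E'.factorization_conductorNorm_eq_one_of_hasMultiplicativeReductionAtPrime p hmE
  have hN0 : E'.conductorNorm ℤ ≠ 0 := (E'.conductorNorm_pos_holds).ne'
  have hpN : p ∣ E'.conductorNorm ℤ := by
    rw [hp.dvd_iff_one_le_factorization hN0, hfac]
  refine ⟨hfac, E'.conductorNorm ℤ / p, (Nat.div_mul_cancel hpN).symm, fun hd ↦ ?_, fun h0 ↦ ?_⟩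
  · have h2 : p ^ 2 ∣ E'.conductorNorm ℤ := by
      rw [← Nat.div_mul_cancel hpN, pow_two]
      exact mul_dvd_mul hd dvd_rfl
    have := (hp.pow_dvd_iff_le_factorization hN0).mp h2
    omega
  · apply hN0
    rw [← Nat.div_mul_cancel hpN, h0, zero_mul]

/-- **`ρ̄_{E′,p}` is onto when `ρ̄_{W,p}` is** (`E′ ≅ W^{(d₁)}`, `d₁ ≠ 0`). [cite: SilvermanAEC2009, X.5 Cor. 5.4]
[cite: RouseZureickbrown2015, Remark 1.6] -/
theorem hasSurjectiveModNGaloisRep_of_twist_presentation (W E' : WeierstrassCurve ℚ) [W.IsElliptic]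
    {d₁ : ℤ} (hE' : ∃ C : VariableChange ℚ, C • W.quadraticTwist (d₁ : ℚ) = E') (hd0 : d₁ ≠ 0)
    {p : ℕ} [Fact p.Prime] (hsurj : W.HasSurjectiveModNGaloisRep p) : E'.HasSurjectiveModNGaloisRep p := by
  obtain ⟨C, hC⟩ := hE'
  have hp : p.Prime := Fact.out
  have h := hasSurjectiveModNGaloisRep_quadraticTwist W (show (d₁ : ℚ) ≠ 0 by exact_mod_cast hd0) hp.ne_zero hsurj
  rw [← hC]
  exact (hasSurjectiveModNGaloisRep_smul_iff _ C (p : ℤ)).mpr h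

/-- **`v_p Δ_min(E′) = v_p Δ_min(W)`** for globally minimal `E′ ≅ W^{(d₁)}` at an odd prime `p ∤ d₁` (`p` is
unramified in `ℚ(√d₁)`). [cite: SilvermanAEC2009, VIII.8 and VII.1 Prop. 1.3] -/
theorem padicValInt_minimalDiscriminantInt_of_twist_presentation (W E' : WeierstrassCurve ℚ) [W.IsElliptic]
    [W.IsGloballyMinimal] [E'.IsElliptic] [E'.IsGloballyMinimal] {d₁ : ℤ}
    (hE' : ∃ C : VariableChange ℚ, C • W.quadraticTwist (d₁ : ℚ) = E')
    {p : ℕ} [Fact p.Prime] (hp2 : p ≠ 2) (hpd : ¬ (p : ℤ) ∣ d₁) :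
    padicValInt p E'.minimalDiscriminantInt = padicValInt p W.minimalDiscriminantInt := by
  obtain ⟨C, hC⟩ := hE'
  have hC' : C⁻¹ • E' = W.quadraticTwist (d₁ : ℚ) := by rw [← hC, inv_smul_smul]
  have hnr : ¬ RamifiedInQuadratic d₁ p := by
    rintro (h | ⟨h2, -⟩)
    · exact hpd h
    · exact hp2 h2
  exact padicValInt_minimalDiscriminantInt_eq_of_twist_of_not_ramifiedInQuadratic W E' hC' hnr

end Frame

end Summit.BirchSwinnertonDyer.BirchSwinnertonDyer.Theorems.GenusKolyvagin
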